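import Summits.SmoothPoincare4.SmoothPoincare4.Theses.QuotientSpheres
import Literature.Topology.FourManifolds.RotationalQuotientFour
import HarnessLib
import HarnessLib.Audit

/-!
# Birth skeleton (BC3) for crux `QuotientSpheres.CyclicQuotient` (item stmt-SmoothPoincare4-8190)

Line `birth` — the PRIME-ORDER REDUCTION of QUOT₍≥₃₎ (the tower of intermediate cyclic branched quotients).

THE CRUX (verbatim the route decl `Summit.SmoothPoincare4.SmoothPoincare4.Theses.QuotientSpheres.CyclicQuotient`, rank 4, deps InvolutionQuotient):
for every `n ≥ 3`, every order-`n` cyclic branched quotient `M` of the STANDARD `S⁴` — data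
`(g, M, q)`: `g : S⁴ → S⁴` smooth with `g^[n] = id` and a fixed point, `q : S⁴ → M` a smooth
surjection onto a smooth 4-manifold `M` (Hausdorff, second countable) whose fibres are the
`⟨g⟩`-orbits, a local diffeomorphism off `Fix g`, with Hambleton–Hausmann fold charts
`ψ ∘ q = foldₙ ∘ φ`, `foldₙ (z, w) = (z, wⁿ)`, at the points of `Fix g` — is diffeomorphic to `S⁴`.

THE LINE. `ℤ/n` has a composition series; a cyclic branched quotient of composite order `n = a·b`
is reached in two steps, `S⁴ → N := S⁴/⟨g^b⟩ → M = N/⟨ḡ⟩`, through an INTERMEDIATE quotient `N` of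
order `a` on which the residual symmetry `ḡ` (order `b`, fixed surface `q₁(Fix g)`, same fold type)
acts. If `N ≅ S⁴` (induction, or `InvolutionQuotient` when `a = 2`) then `M` is an order-`b`
cyclic branched quotient of the standard `S⁴` again, and we descend. What is left at the bottom is
the PRIME-ORDER case — `p = 2` is the route's other crux `InvolutionQuotient` (the declared
dependency of this crux), `p` odd is STUB 1 — exactly the regime where the tools for cyclic actions
are sharpest (P. A. Smith theory for `ℤ/p` on mod-`p` homology spheres; Plotnick's equivariant
intersection forms and the classification of `ℤ/p`-rotations of homotopy 4-spheres about 2-spheres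
up to concordance, Plotnick1986 / McCooey; Sumners1975, Pao1978 for the supply). The shape is the
classical exponent reduction (FLT ⇐ FLT(4) ∧ FLT(odd primes)).

* STUB 1 `stub_oddPrimeOrder` — QUOT for ODD PRIME order: the crux restricted to `n = p` an odd
  prime. OPEN (the load-bearing stub; strictly a special case of the crux; with `InvolutionQuotient`
  it is "prime-order cyclic branched quotients of `S⁴` are standard"). It is NOT the crux: composite
  orders (`4, 6, 8, 9, …`) are out of its reach without STUB 2, and nothing in the tree turns it into
  `CyclicQuotient` or `SmoothPoincare4` (BC3 probes, see the line card).
* STUB 2 `stub_towerDescent` — the TOWER LEMMA (known in substance, never written for this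
  predicate; Lean size L–XL): for `n = a·b` (`a, b ≥ 2`) and order-`n` data `(g, M, q)` with a fixed
  point there is a smooth 4-manifold `N` with order-`a` data `(g^[b], N, q₁)` (existence of the
  intermediate quotient with its canonical smooth structure — HambletonHausmann2010 App. Lemma 7.3
  for `ℤ/2`, verbatim for `ℤ/a` along a fixed surface — with the fold charts `fold_a ∘ φ` built from
  the GIVEN charts `φ` of the datum, which are `fold_a`-compatible BECAUSE they are
  `fold_n`-compatible: formally `φ' ∘ φ⁻¹ = (p, z) ↦ (P(p, zⁿ), c(p)·z·S(p, zⁿ)^(1/n))` up to a flat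
  equivariant term), and, for every diffeomorphism `e : N ≅ S⁴`, order-`b` data `(g', M, q')` on the
  standard sphere with the SAME target `M` (the residual deck transformation `ḡ`, `ḡ ∘ q₁ = q₁ ∘ g`,
  and the factor map `q̄`, `q̄ ∘ q₁ = q`, transported along `e`: `g' = e ∘ ḡ ∘ e⁻¹`, `q' = q̄ ∘ e⁻¹`;
  `ψ ∘ q̄ = fold_b ∘ ψ₁` in the charts just built, `Fix ḡ = q₁(Fix g)` by semifreeness, which the
  datum forces: `g x ≠ x →` `q` is a local diffeomorphism at `x`). It is NOT the crux: it recognises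
  nothing (its output is again a cyclic branched quotient, of smaller order).

COMPOSITION (kernel-checked, no `sorry` outside the two stubs): `cyclicQuotient_of_stubs : <stub₁-sig> →
<stub₂-sig> → InvolutionQuotient → <the crux statement>` by strong induction on `n` (prime `n ≥ 3` ⇒
STUB 1; composite `n = minFac n · (n / minFac n)` ⇒ STUB 2, the intermediate quotient is standard by
`InvolutionQuotient` (order 2) or the induction hypothesis (order ≥ 3), then the order-`b` datum on the
standard sphere with target `M` is standard likewise), and THE skeleton theorem
`CyclicQuotient_of (hI : InvolutionQuotient) : QuotientSpheres.CyclicQuotient` — the crux BY NAME, closed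
modulo the two registered stubs and the route's declared dependency `InvolutionQuotient` (item
stmt-SmoothPoincare4-8188, a `@[route_item]` of the same route and a binder of its `closes`; the audit
admits registered obligations by name). Even orders cannot avoid an order-2 layer (`ℤ/2` is a
composition factor of `ℤ/n` for even `n`), so this dependency is intrinsic to any tower, not a choice.
The fold model is written `Literature.Topology.FourManifolds.rotationFoldModel n (φ y)` (definition D1
filed for this very crux; `rotationFoldModel_apply` is `rfl`), definitionally the route's inlined
`WithLp.toLp 2 (fun j => if j = 2 then … else …)`, so the stubs are stated over tree declarations only and
the crux is still concluded by name.

DISPROOF USED: no `Disproof.lean` exists for this crux (`ledger crux ls stmt-SmoothPoincare4-8190`: no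
workfiles, 2026-08-17); negatives index for SmoothPoincare4: 0 refuted statements (2026-08-17). Refuter
route-review (2026-08-15): the inlined predicate survives junk models (reflection, `Fix = S¹`, free
involution excluded; `g = id` harmless) — both stubs keep the predicate verbatim (with its fixed-point
clause), so neither is vacuous-by-junk; STUB 2's existential `N` is inhabited in kind by the linear
models (route support item `LinearQuotientModel`: `S⁴` is its own order-`a` quotient).

BARRIERS: `CircleActionBarrierFour` (finite groups only — void); `ProjectiveRigidityBarrierFour` (free
actions excluded by the fixed-point clause, kept in both stubs); the dimension warning `Θ₇ = ℤ/28`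
(KervaireMilnorAnnals1963) applies to STUB 1 exactly as to the crux: the tower lemma is
dimension-free, the prime case is where 4-dimensional input must enter.
-/

noncomputable section

open scoped Manifold ContDiff Topology

namespace Summit.SmoothPoincare4.SmoothPoincare4.Cruxes.CyclicQuotient.Birth

set_option linter.dupNamespace false
set_option linter.unusedVariables false

/-! ## The two registered stubs (`sorry` lives ONLY here; signatures over tree declarations only) -/

/-- STUB 1 (registered) — QUOT FOR ODD PRIME ORDER: for every prime `p ≥ 3`, every order-`p` cyclic
branched quotient `M` of the standard `S⁴` (the route's inlined datum `(g, M, q)` with a fixed point, fold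
model `rotationFoldModel p`) is diffeomorphic to `S⁴` — the crux `CyclicQuotient` restricted to prime
order. Size: open problem (the hardest stub). Why plausibly true: every known `ℤ/p`-rotation of `S⁴`
(Giffen1966, Gordon1974, Sumners1975, Pao1978, Plotnick1986: cyclic branched covers of twist-spun knots)
has quotient `S⁴` by construction; for prime order Smith theory and Plotnick's equivariant forms apply.
[cite: Plotnick1986; Pao1978; Sumners1975; HambletonHausmann2010, Appendix §7] -/
theorem stub_oddPrimeOrder :
    ∀ (p : ℕ), p.Prime → 3 ≤ p →
      ∀ (g : Metric.sphere (0 : EuclideanSpace ℝ (Fin 5)) 1 → Metric.sphere (0 : EuclideanSpace ℝ (Fin 5)) 1)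
        (M : Type) [TopologicalSpace M] [T2Space M] [SecondCountableTopology M]
        [ChartedSpace (EuclideanSpace ℝ (Fin 4)) M] [IsManifold (𝓡 4) ∞ M]
        (q : Metric.sphere (0 : EuclideanSpace ℝ (Fin 5)) 1 → M), (∃ x, g x = x) →
        (ContMDiff (𝓡 4) (𝓡 4) ∞ g ∧ g^[p] = id ∧ ContMDiff (𝓡 4) (𝓡 4) ∞ q ∧
          (∀ x, q (g x) = q x) ∧ (∀ x y, q x = q y → ∃ k : ℕ, y = g^[k] x) ∧
          Function.Surjective q ∧ (∀ x, g x ≠ x → IsLocalDiffeomorphAt (𝓡 4) (𝓡 4) ∞ q x) ∧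
          ∀ x, g x = x → ∃ (U : Set (Metric.sphere (0 : EuclideanSpace ℝ (Fin 5)) 1)) (φ : Metric.sphere (0 : EuclideanSpace ℝ (Fin 5)) 1 → EuclideanSpace ℝ (Fin 4))
            (V : Set M) (ψ : M → EuclideanSpace ℝ (Fin 4)), IsOpen U ∧ x ∈ U ∧ Set.InjOn φ U ∧
            (∀ y ∈ U, IsLocalDiffeomorphAt (𝓡 4) (𝓡 4) ∞ φ y) ∧ IsOpen V ∧ q '' U ⊆ V ∧ Set.InjOn ψ V ∧
            (∀ z ∈ V, IsLocalDiffeomorphAt (𝓡 4) (𝓡 4) ∞ ψ z) ∧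
            ∀ y ∈ U, ψ (q y) = Literature.Topology.FourManifolds.rotationFoldModel p (φ y)) →
        Nonempty (M ≃ₘ⟮𝓡 4, 𝓡 4⟯ Metric.sphere (0 : EuclideanSpace ℝ (Fin 5)) 1) := by
  sorry

/-- STUB 2 (registered) — THE TOWER LEMMA (intermediate cyclic branched quotients): for `n = a·b` with
`a, b ≥ 2` and an order-`n` datum `(g, M, q)` with a fixed point, (i) the intermediate quotient
`N = S⁴/⟨g^[b]⟩` exists as a smooth 4-manifold (Hausdorff, second countable) with an order-`a` datum
`(g^[b], N, q₁)` (Hambleton–Hausmann's quotient smooth structure, Lemma 7.3, along the fixed surface,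
charts `fold_a ∘ φ` from the datum's own charts `φ`), and (ii) for every diffeomorphism `e : N ≅ S⁴` the
residual deck transformation and the factor map `N → M`, transported along `e`, form an order-`b` datum
`(g', M, q')` on the standard sphere with the same target `M`. Size: L–XL (a quotient-manifold
construction + the descent computation `ψ ∘ q̄ = fold_b ∘ ψ₁`); known in substance, not in print for
this predicate. [cite: HambletonHausmann2010, Appendix §7, Definition 7.1 / Lemma 7.3 (quotient smooth structure, branched charts)] -/
theorem stub_towerDescent :
    ∀ (n a b : ℕ), 2 ≤ a → 2 ≤ b → n = a * b →
      ∀ (g : Metric.sphere (0 : EuclideanSpace ℝ (Fin 5)) 1 → Metric.sphere (0 : EuclideanSpace ℝ (Fin 5)) 1)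
        (M : Type) [TopologicalSpace M] [T2Space M] [SecondCountableTopology M]
        [ChartedSpace (EuclideanSpace ℝ (Fin 4)) M] [IsManifold (𝓡 4) ∞ M]
        (q : Metric.sphere (0 : EuclideanSpace ℝ (Fin 5)) 1 → M), (∃ x, g x = x) →
        (ContMDiff (𝓡 4) (𝓡 4) ∞ g ∧ g^[n] = id ∧ ContMDiff (𝓡 4) (𝓡 4) ∞ q ∧
          (∀ x, q (g x) = q x) ∧ (∀ x y, q x = q y → ∃ k : ℕ, y = g^[k] x) ∧
          Function.Surjective q ∧ (∀ x, g x ≠ x → IsLocalDiffeomorphAt (𝓡 4) (𝓡 4) ∞ q x) ∧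
          ∀ x, g x = x → ∃ (U : Set (Metric.sphere (0 : EuclideanSpace ℝ (Fin 5)) 1)) (φ : Metric.sphere (0 : EuclideanSpace ℝ (Fin 5)) 1 → EuclideanSpace ℝ (Fin 4))
            (V : Set M) (ψ : M → EuclideanSpace ℝ (Fin 4)), IsOpen U ∧ x ∈ U ∧ Set.InjOn φ U ∧
            (∀ y ∈ U, IsLocalDiffeomorphAt (𝓡 4) (𝓡 4) ∞ φ y) ∧ IsOpen V ∧ q '' U ⊆ V ∧ Set.InjOn ψ V ∧
            (∀ z ∈ V, IsLocalDiffeomorphAt (𝓡 4) (𝓡 4) ∞ ψ z) ∧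
            ∀ y ∈ U, ψ (q y) = Literature.Topology.FourManifolds.rotationFoldModel n (φ y)) →
        ∃ (N : Type) (_ : TopologicalSpace N) (_ : T2Space N) (_ : SecondCountableTopology N)
        (_ : ChartedSpace (EuclideanSpace ℝ (Fin 4)) N) (_ : IsManifold (𝓡 4) ∞ N)
        (q₁ : Metric.sphere (0 : EuclideanSpace ℝ (Fin 5)) 1 → N),
        ((∃ x, g^[b] x = x) ∧
          (ContMDiff (𝓡 4) (𝓡 4) ∞ (g^[b]) ∧ (g^[b])^[a] = id ∧ ContMDiff (𝓡 4) (𝓡 4) ∞ q₁ ∧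
            (∀ x, q₁ ((g^[b]) x) = q₁ x) ∧ (∀ x y, q₁ x = q₁ y → ∃ k : ℕ, y = (g^[b])^[k] x) ∧
            Function.Surjective q₁ ∧ (∀ x, (g^[b]) x ≠ x → IsLocalDiffeomorphAt (𝓡 4) (𝓡 4) ∞ q₁ x) ∧
            ∀ x, (g^[b]) x = x → ∃ (U : Set (Metric.sphere (0 : EuclideanSpace ℝ (Fin 5)) 1)) (φ : Metric.sphere (0 : EuclideanSpace ℝ (Fin 5)) 1 → EuclideanSpace ℝ (Fin 4))
              (V : Set N) (ψ : N → EuclideanSpace ℝ (Fin 4)), IsOpen U ∧ x ∈ U ∧ Set.InjOn φ U ∧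
              (∀ y ∈ U, IsLocalDiffeomorphAt (𝓡 4) (𝓡 4) ∞ φ y) ∧ IsOpen V ∧ q₁ '' U ⊆ V ∧ Set.InjOn ψ V ∧
              (∀ z ∈ V, IsLocalDiffeomorphAt (𝓡 4) (𝓡 4) ∞ ψ z) ∧
              ∀ y ∈ U, ψ (q₁ y) = Literature.Topology.FourManifolds.rotationFoldModel a (φ y))) ∧
        ∀ e : N ≃ₘ⟮𝓡 4, 𝓡 4⟯ Metric.sphere (0 : EuclideanSpace ℝ (Fin 5)) 1,
          ∃ (g' : Metric.sphere (0 : EuclideanSpace ℝ (Fin 5)) 1 → Metric.sphere (0 : EuclideanSpace ℝ (Fin 5)) 1) (q' : Metric.sphere (0 : EuclideanSpace ℝ (Fin 5)) 1 → M),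
            (∃ x, g' x = x) ∧
            (ContMDiff (𝓡 4) (𝓡 4) ∞ g' ∧ g'^[b] = id ∧ ContMDiff (𝓡 4) (𝓡 4) ∞ q' ∧
              (∀ x, q' (g' x) = q' x) ∧ (∀ x y, q' x = q' y → ∃ k : ℕ, y = g'^[k] x) ∧
              Function.Surjective q' ∧ (∀ x, g' x ≠ x → IsLocalDiffeomorphAt (𝓡 4) (𝓡 4) ∞ q' x) ∧
              ∀ x, g' x = x → ∃ (U : Set (Metric.sphere (0 : EuclideanSpace ℝ (Fin 5)) 1)) (φ : Metric.sphere (0 : EuclideanSpace ℝ (Fin 5)) 1 → EuclideanSpace ℝ (Fin 4))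
                (V : Set M) (ψ : M → EuclideanSpace ℝ (Fin 4)), IsOpen U ∧ x ∈ U ∧ Set.InjOn φ U ∧
                (∀ y ∈ U, IsLocalDiffeomorphAt (𝓡 4) (𝓡 4) ∞ φ y) ∧ IsOpen V ∧ q' '' U ⊆ V ∧ Set.InjOn ψ V ∧
                (∀ z ∈ V, IsLocalDiffeomorphAt (𝓡 4) (𝓡 4) ∞ ψ z) ∧
                ∀ y ∈ U, ψ (q' y) = Literature.Topology.FourManifolds.rotationFoldModel b (φ y)) := by
  sorry

/-! ## Composition: stubs ⟹ crux (no `sorry` below this line) -/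

/-- **Prime-order reduction, arrow form.** STUB 1 (odd primes) + STUB 2 (tower) + the route's crux
`InvolutionQuotient` (order 2) give the statement of `CyclicQuotient` (with the fold model spelled
`rotationFoldModel`, definitionally the route's inlined formula), by strong induction on the order `n`:
a prime order is STUB 1; a composite order `n = a·b` (`a = minFac n`, `b = n / a`, both in `[2, n)`)
passes through the intermediate quotient of STUB 2, which is standard by `InvolutionQuotient` (`a = 2`)
or the induction hypothesis (`a ≥ 3`), and then `M` is an order-`b` quotient of the standard sphere,
standard likewise. -/
theorem cyclicQuotient_of_stubs
    (h₁ :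
      ∀ (p : ℕ), p.Prime → 3 ≤ p →
        ∀ (g : Metric.sphere (0 : EuclideanSpace ℝ (Fin 5)) 1 → Metric.sphere (0 : EuclideanSpace ℝ (Fin 5)) 1)
          (M : Type) [TopologicalSpace M] [T2Space M] [SecondCountableTopology M]
          [ChartedSpace (EuclideanSpace ℝ (Fin 4)) M] [IsManifold (𝓡 4) ∞ M]
          (q : Metric.sphere (0 : EuclideanSpace ℝ (Fin 5)) 1 → M), (∃ x, g x = x) →
          (ContMDiff (𝓡 4) (𝓡 4) ∞ g ∧ g^[p] = id ∧ ContMDiff (𝓡 4) (𝓡 4) ∞ q ∧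
            (∀ x, q (g x) = q x) ∧ (∀ x y, q x = q y → ∃ k : ℕ, y = g^[k] x) ∧
            Function.Surjective q ∧ (∀ x, g x ≠ x → IsLocalDiffeomorphAt (𝓡 4) (𝓡 4) ∞ q x) ∧
            ∀ x, g x = x → ∃ (U : Set (Metric.sphere (0 : EuclideanSpace ℝ (Fin 5)) 1)) (φ : Metric.sphere (0 : EuclideanSpace ℝ (Fin 5)) 1 → EuclideanSpace ℝ (Fin 4))
              (V : Set M) (ψ : M → EuclideanSpace ℝ (Fin 4)), IsOpen U ∧ x ∈ U ∧ Set.InjOn φ U ∧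
              (∀ y ∈ U, IsLocalDiffeomorphAt (𝓡 4) (𝓡 4) ∞ φ y) ∧ IsOpen V ∧ q '' U ⊆ V ∧ Set.InjOn ψ V ∧
              (∀ z ∈ V, IsLocalDiffeomorphAt (𝓡 4) (𝓡 4) ∞ ψ z) ∧
              ∀ y ∈ U, ψ (q y) = Literature.Topology.FourManifolds.rotationFoldModel p (φ y)) →
          Nonempty (M ≃ₘ⟮𝓡 4, 𝓡 4⟯ Metric.sphere (0 : EuclideanSpace ℝ (Fin 5)) 1))
    (h₂ :
      ∀ (n a b : ℕ), 2 ≤ a → 2 ≤ b → n = a * b →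
        ∀ (g : Metric.sphere (0 : EuclideanSpace ℝ (Fin 5)) 1 → Metric.sphere (0 : EuclideanSpace ℝ (Fin 5)) 1)
          (M : Type) [TopologicalSpace M] [T2Space M] [SecondCountableTopology M]
          [ChartedSpace (EuclideanSpace ℝ (Fin 4)) M] [IsManifold (𝓡 4) ∞ M]
          (q : Metric.sphere (0 : EuclideanSpace ℝ (Fin 5)) 1 → M), (∃ x, g x = x) →
          (ContMDiff (𝓡 4) (𝓡 4) ∞ g ∧ g^[n] = id ∧ ContMDiff (𝓡 4) (𝓡 4) ∞ q ∧
            (∀ x, q (g x) = q x) ∧ (∀ x y, q x = q y → ∃ k : ℕ, y = g^[k] x) ∧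
            Function.Surjective q ∧ (∀ x, g x ≠ x → IsLocalDiffeomorphAt (𝓡 4) (𝓡 4) ∞ q x) ∧
            ∀ x, g x = x → ∃ (U : Set (Metric.sphere (0 : EuclideanSpace ℝ (Fin 5)) 1)) (φ : Metric.sphere (0 : EuclideanSpace ℝ (Fin 5)) 1 → EuclideanSpace ℝ (Fin 4))
              (V : Set M) (ψ : M → EuclideanSpace ℝ (Fin 4)), IsOpen U ∧ x ∈ U ∧ Set.InjOn φ U ∧
              (∀ y ∈ U, IsLocalDiffeomorphAt (𝓡 4) (𝓡 4) ∞ φ y) ∧ IsOpen V ∧ q '' U ⊆ V ∧ Set.InjOn ψ V ∧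
              (∀ z ∈ V, IsLocalDiffeomorphAt (𝓡 4) (𝓡 4) ∞ ψ z) ∧
              ∀ y ∈ U, ψ (q y) = Literature.Topology.FourManifolds.rotationFoldModel n (φ y)) →
          ∃ (N : Type) (_ : TopologicalSpace N) (_ : T2Space N) (_ : SecondCountableTopology N)
          (_ : ChartedSpace (EuclideanSpace ℝ (Fin 4)) N) (_ : IsManifold (𝓡 4) ∞ N)
          (q₁ : Metric.sphere (0 : EuclideanSpace ℝ (Fin 5)) 1 → N),
          ((∃ x, g^[b] x = x) ∧
            (ContMDiff (𝓡 4) (𝓡 4) ∞ (g^[b]) ∧ (g^[b])^[a] = id ∧ ContMDiff (𝓡 4) (𝓡 4) ∞ q₁ ∧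
              (∀ x, q₁ ((g^[b]) x) = q₁ x) ∧ (∀ x y, q₁ x = q₁ y → ∃ k : ℕ, y = (g^[b])^[k] x) ∧
              Function.Surjective q₁ ∧ (∀ x, (g^[b]) x ≠ x → IsLocalDiffeomorphAt (𝓡 4) (𝓡 4) ∞ q₁ x) ∧
              ∀ x, (g^[b]) x = x → ∃ (U : Set (Metric.sphere (0 : EuclideanSpace ℝ (Fin 5)) 1)) (φ : Metric.sphere (0 : EuclideanSpace ℝ (Fin 5)) 1 → EuclideanSpace ℝ (Fin 4))
                (V : Set N) (ψ : N → EuclideanSpace ℝ (Fin 4)), IsOpen U ∧ x ∈ U ∧ Set.InjOn φ U ∧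
                (∀ y ∈ U, IsLocalDiffeomorphAt (𝓡 4) (𝓡 4) ∞ φ y) ∧ IsOpen V ∧ q₁ '' U ⊆ V ∧ Set.InjOn ψ V ∧
                (∀ z ∈ V, IsLocalDiffeomorphAt (𝓡 4) (𝓡 4) ∞ ψ z) ∧
                ∀ y ∈ U, ψ (q₁ y) = Literature.Topology.FourManifolds.rotationFoldModel a (φ y))) ∧
          ∀ e : N ≃ₘ⟮𝓡 4, 𝓡 4⟯ Metric.sphere (0 : EuclideanSpace ℝ (Fin 5)) 1,
            ∃ (g' : Metric.sphere (0 : EuclideanSpace ℝ (Fin 5)) 1 → Metric.sphere (0 : EuclideanSpace ℝ (Fin 5)) 1) (q' : Metric.sphere (0 : EuclideanSpace ℝ (Fin 5)) 1 → M),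
              (∃ x, g' x = x) ∧
              (ContMDiff (𝓡 4) (𝓡 4) ∞ g' ∧ g'^[b] = id ∧ ContMDiff (𝓡 4) (𝓡 4) ∞ q' ∧
                (∀ x, q' (g' x) = q' x) ∧ (∀ x y, q' x = q' y → ∃ k : ℕ, y = g'^[k] x) ∧
                Function.Surjective q' ∧ (∀ x, g' x ≠ x → IsLocalDiffeomorphAt (𝓡 4) (𝓡 4) ∞ q' x) ∧
                ∀ x, g' x = x → ∃ (U : Set (Metric.sphere (0 : EuclideanSpace ℝ (Fin 5)) 1)) (φ : Metric.sphere (0 : EuclideanSpace ℝ (Fin 5)) 1 → EuclideanSpace ℝ (Fin 4))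
                  (V : Set M) (ψ : M → EuclideanSpace ℝ (Fin 4)), IsOpen U ∧ x ∈ U ∧ Set.InjOn φ U ∧
                  (∀ y ∈ U, IsLocalDiffeomorphAt (𝓡 4) (𝓡 4) ∞ φ y) ∧ IsOpen V ∧ q' '' U ⊆ V ∧ Set.InjOn ψ V ∧
                  (∀ z ∈ V, IsLocalDiffeomorphAt (𝓡 4) (𝓡 4) ∞ ψ z) ∧
                  ∀ y ∈ U, ψ (q' y) = Literature.Topology.FourManifolds.rotationFoldModel b (φ y)))
    (hI : Summit.SmoothPoincare4.SmoothPoincare4.Theses.QuotientSpheres.InvolutionQuotient) :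
    ∀ (n : ℕ), 3 ≤ n →
      ∀ (g : Metric.sphere (0 : EuclideanSpace ℝ (Fin 5)) 1 → Metric.sphere (0 : EuclideanSpace ℝ (Fin 5)) 1)
        (M : Type) [TopologicalSpace M] [T2Space M] [SecondCountableTopology M]
        [ChartedSpace (EuclideanSpace ℝ (Fin 4)) M] [IsManifold (𝓡 4) ∞ M]
        (q : Metric.sphere (0 : EuclideanSpace ℝ (Fin 5)) 1 → M), (∃ x, g x = x) →
        (ContMDiff (𝓡 4) (𝓡 4) ∞ g ∧ g^[n] = id ∧ ContMDiff (𝓡 4) (𝓡 4) ∞ q ∧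
          (∀ x, q (g x) = q x) ∧ (∀ x y, q x = q y → ∃ k : ℕ, y = g^[k] x) ∧
          Function.Surjective q ∧ (∀ x, g x ≠ x → IsLocalDiffeomorphAt (𝓡 4) (𝓡 4) ∞ q x) ∧
          ∀ x, g x = x → ∃ (U : Set (Metric.sphere (0 : EuclideanSpace ℝ (Fin 5)) 1)) (φ : Metric.sphere (0 : EuclideanSpace ℝ (Fin 5)) 1 → EuclideanSpace ℝ (Fin 4))
            (V : Set M) (ψ : M → EuclideanSpace ℝ (Fin 4)), IsOpen U ∧ x ∈ U ∧ Set.InjOn φ U ∧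
            (∀ y ∈ U, IsLocalDiffeomorphAt (𝓡 4) (𝓡 4) ∞ φ y) ∧ IsOpen V ∧ q '' U ⊆ V ∧ Set.InjOn ψ V ∧
            (∀ z ∈ V, IsLocalDiffeomorphAt (𝓡 4) (𝓡 4) ∞ ψ z) ∧
            ∀ y ∈ U, ψ (q y) = Literature.Topology.FourManifolds.rotationFoldModel n (φ y)) →
        Nonempty (M ≃ₘ⟮𝓡 4, 𝓡 4⟯ Metric.sphere (0 : EuclideanSpace ℝ (Fin 5)) 1) := by
  -- `InvolutionQuotient` in `rotationFoldModel` spelling (definitional unfolding of the route decl).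
  have hI' :
      ∀ (g : Metric.sphere (0 : EuclideanSpace ℝ (Fin 5)) 1 → Metric.sphere (0 : EuclideanSpace ℝ (Fin 5)) 1)
          (M : Type) [TopologicalSpace M] [T2Space M] [SecondCountableTopology M]
          [ChartedSpace (EuclideanSpace ℝ (Fin 4)) M] [IsManifold (𝓡 4) ∞ M]
          (q : Metric.sphere (0 : EuclideanSpace ℝ (Fin 5)) 1 → M), (∃ x, g x = x) →
          (ContMDiff (𝓡 4) (𝓡 4) ∞ g ∧ g^[2] = id ∧ ContMDiff (𝓡 4) (𝓡 4) ∞ q ∧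
            (∀ x, q (g x) = q x) ∧ (∀ x y, q x = q y → ∃ k : ℕ, y = g^[k] x) ∧
            Function.Surjective q ∧ (∀ x, g x ≠ x → IsLocalDiffeomorphAt (𝓡 4) (𝓡 4) ∞ q x) ∧
            ∀ x, g x = x → ∃ (U : Set (Metric.sphere (0 : EuclideanSpace ℝ (Fin 5)) 1)) (φ : Metric.sphere (0 : EuclideanSpace ℝ (Fin 5)) 1 → EuclideanSpace ℝ (Fin 4))
              (V : Set M) (ψ : M → EuclideanSpace ℝ (Fin 4)), IsOpen U ∧ x ∈ U ∧ Set.InjOn φ U ∧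
              (∀ y ∈ U, IsLocalDiffeomorphAt (𝓡 4) (𝓡 4) ∞ φ y) ∧ IsOpen V ∧ q '' U ⊆ V ∧ Set.InjOn ψ V ∧
              (∀ z ∈ V, IsLocalDiffeomorphAt (𝓡 4) (𝓡 4) ∞ ψ z) ∧
              ∀ y ∈ U, ψ (q y) = Literature.Topology.FourManifolds.rotationFoldModel 2 (φ y)) →
          Nonempty (M ≃ₘ⟮𝓡 4, 𝓡 4⟯ Metric.sphere (0 : EuclideanSpace ℝ (Fin 5)) 1) := by
    intro g M _ _ _ _ _ q hfix hdata
    exact hI g M q hfix hdata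
  intro n
  induction n using Nat.strong_induction_on with
  | _ n ih =>
    intro hn g M _ _ _ _ _ q hfix hdata
    by_cases hp : n.Prime
    · exact h₁ n hp hn g M q hfix hdata
    · -- composite order: n = a * b with a = minFac n, b = n / minFac n, both in [2, n)
      have hn1 : n ≠ 1 := by omega
      have hn0 : 0 < n := by omega
      have ha2 : 2 ≤ n.minFac := (Nat.minFac_prime hn1).two_le
      have halt : n.minFac < n := (Nat.not_prime_iff_minFac_lt (by omega)).mp hp
      have hdvd : n.minFac ∣ n := Nat.minFac_dvd n
      have hab : n = n.minFac * (n / n.minFac) := (Nat.mul_div_cancel' hdvd).symm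
      have hblt : n / n.minFac < n := Nat.div_lt_self hn0 (by omega)
      have hb2 : 2 ≤ n / n.minFac := by
        by_contra hb
        have hb1 : n / n.minFac ≤ 1 := by omega
        have hle : n ≤ n.minFac := by
          calc n = n.minFac * (n / n.minFac) := hab
            _ ≤ n.minFac * 1 := Nat.mul_le_mul_left _ hb1
            _ = n.minFac := Nat.mul_one _
        omega
      -- the two-step descent, for abstract `a`, `b`
      have key : ∀ a b : ℕ, 2 ≤ a → a < n → 2 ≤ b → b < n → n = a * b →
          Nonempty (M ≃ₘ⟮𝓡 4, 𝓡 4⟯ Metric.sphere (0 : EuclideanSpace ℝ (Fin 5)) 1) := by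
        intro a b ha halt' hb hblt' hab'
        obtain ⟨N, _, _, _, _, _, q₁, ⟨hfix₁, hdata₁⟩, hdesc⟩ :=
          h₂ n a b ha hb hab' g M q hfix hdata
        -- the intermediate quotient is standard
        have hN : Nonempty (N ≃ₘ⟮𝓡 4, 𝓡 4⟯ Metric.sphere (0 : EuclideanSpace ℝ (Fin 5)) 1) := by
          rcases Nat.lt_or_ge a 3 with hlt3 | hge3
          · obtain rfl : a = 2 := by omega
            exact hI' _ N q₁ hfix₁ hdata₁
          · exact ih a halt' hge3 _ N q₁ hfix₁ hdata₁
        obtain ⟨e⟩ := hN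
        -- so `M` is an order-`b` cyclic branched quotient of the standard sphere
        obtain ⟨g', q', hfix', hdata'⟩ := hdesc e
        rcases Nat.lt_or_ge b 3 with hlt3 | hge3
        · obtain rfl : b = 2 := by omega
          exact hI' g' M q' hfix' hdata'
        · exact ih b hblt' hge3 g' M q' hfix' hdata'
      exact key n.minFac (n / n.minFac) ha2 halt hb2 hblt hab

/-- **`CyclicQuotient_of` — THE SKELETON**: the crux `QuotientSpheres.CyclicQuotient` BY NAME, closed modulo
the two registered stubs and the route's declared dependency `InvolutionQuotient` (crux item
stmt-SmoothPoincare4-8188 of the same route, a binder of its `closes`; D-0027 §3.3 shape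
`<Crux>_proof := crux_of stub₁_holds stub₂_holds`). Becomes the (conditional-on-`InvolutionQuotient`) crux
proof when both stubs are discharged. -/
theorem CyclicQuotient_of (hI : Summit.SmoothPoincare4.SmoothPoincare4.Theses.QuotientSpheres.InvolutionQuotient) :
    Summit.SmoothPoincare4.SmoothPoincare4.Theses.QuotientSpheres.CyclicQuotient :=
  cyclicQuotient_of_stubs stub_oddPrimeOrder stub_towerDescent hI

/-- BC3 letter: `<stub₁-sig> → <stub₂-sig> → InvolutionQuotient → CyclicQuotient` with the crux BY NAME (an
`example`, so that `CyclicQuotient_of` stays the only by-name candidate the skeleton audit sees). -/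
example :
    (
      ∀ (p : ℕ), p.Prime → 3 ≤ p →
        ∀ (g : Metric.sphere (0 : EuclideanSpace ℝ (Fin 5)) 1 → Metric.sphere (0 : EuclideanSpace ℝ (Fin 5)) 1)
          (M : Type) [TopologicalSpace M] [T2Space M] [SecondCountableTopology M]
          [ChartedSpace (EuclideanSpace ℝ (Fin 4)) M] [IsManifold (𝓡 4) ∞ M]
          (q : Metric.sphere (0 : EuclideanSpace ℝ (Fin 5)) 1 → M), (∃ x, g x = x) →
          (ContMDiff (𝓡 4) (𝓡 4) ∞ g ∧ g^[p] = id ∧ ContMDiff (𝓡 4) (𝓡 4) ∞ q ∧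
            (∀ x, q (g x) = q x) ∧ (∀ x y, q x = q y → ∃ k : ℕ, y = g^[k] x) ∧
            Function.Surjective q ∧ (∀ x, g x ≠ x → IsLocalDiffeomorphAt (𝓡 4) (𝓡 4) ∞ q x) ∧
            ∀ x, g x = x → ∃ (U : Set (Metric.sphere (0 : EuclideanSpace ℝ (Fin 5)) 1)) (φ : Metric.sphere (0 : EuclideanSpace ℝ (Fin 5)) 1 → EuclideanSpace ℝ (Fin 4))
              (V : Set M) (ψ : M → EuclideanSpace ℝ (Fin 4)), IsOpen U ∧ x ∈ U ∧ Set.InjOn φ U ∧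
              (∀ y ∈ U, IsLocalDiffeomorphAt (𝓡 4) (𝓡 4) ∞ φ y) ∧ IsOpen V ∧ q '' U ⊆ V ∧ Set.InjOn ψ V ∧
              (∀ z ∈ V, IsLocalDiffeomorphAt (𝓡 4) (𝓡 4) ∞ ψ z) ∧
              ∀ y ∈ U, ψ (q y) = Literature.Topology.FourManifolds.rotationFoldModel p (φ y)) →
          Nonempty (M ≃ₘ⟮𝓡 4, 𝓡 4⟯ Metric.sphere (0 : EuclideanSpace ℝ (Fin 5)) 1)) →
    (
      ∀ (n a b : ℕ), 2 ≤ a → 2 ≤ b → n = a * b →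
        ∀ (g : Metric.sphere (0 : EuclideanSpace ℝ (Fin 5)) 1 → Metric.sphere (0 : EuclideanSpace ℝ (Fin 5)) 1)
          (M : Type) [TopologicalSpace M] [T2Space M] [SecondCountableTopology M]
          [ChartedSpace (EuclideanSpace ℝ (Fin 4)) M] [IsManifold (𝓡 4) ∞ M]
          (q : Metric.sphere (0 : EuclideanSpace ℝ (Fin 5)) 1 → M), (∃ x, g x = x) →
          (ContMDiff (𝓡 4) (𝓡 4) ∞ g ∧ g^[n] = id ∧ ContMDiff (𝓡 4) (𝓡 4) ∞ q ∧
            (∀ x, q (g x) = q x) ∧ (∀ x y, q x = q y → ∃ k : ℕ, y = g^[k] x) ∧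
            Function.Surjective q ∧ (∀ x, g x ≠ x → IsLocalDiffeomorphAt (𝓡 4) (𝓡 4) ∞ q x) ∧
            ∀ x, g x = x → ∃ (U : Set (Metric.sphere (0 : EuclideanSpace ℝ (Fin 5)) 1)) (φ : Metric.sphere (0 : EuclideanSpace ℝ (Fin 5)) 1 → EuclideanSpace ℝ (Fin 4))
              (V : Set M) (ψ : M → EuclideanSpace ℝ (Fin 4)), IsOpen U ∧ x ∈ U ∧ Set.InjOn φ U ∧
              (∀ y ∈ U, IsLocalDiffeomorphAt (𝓡 4) (𝓡 4) ∞ φ y) ∧ IsOpen V ∧ q '' U ⊆ V ∧ Set.InjOn ψ V ∧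
              (∀ z ∈ V, IsLocalDiffeomorphAt (𝓡 4) (𝓡 4) ∞ ψ z) ∧
              ∀ y ∈ U, ψ (q y) = Literature.Topology.FourManifolds.rotationFoldModel n (φ y)) →
          ∃ (N : Type) (_ : TopologicalSpace N) (_ : T2Space N) (_ : SecondCountableTopology N)
          (_ : ChartedSpace (EuclideanSpace ℝ (Fin 4)) N) (_ : IsManifold (𝓡 4) ∞ N)
          (q₁ : Metric.sphere (0 : EuclideanSpace ℝ (Fin 5)) 1 → N),
          ((∃ x, g^[b] x = x) ∧
            (ContMDiff (𝓡 4) (𝓡 4) ∞ (g^[b]) ∧ (g^[b])^[a] = id ∧ ContMDiff (𝓡 4) (𝓡 4) ∞ q₁ ∧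
              (∀ x, q₁ ((g^[b]) x) = q₁ x) ∧ (∀ x y, q₁ x = q₁ y → ∃ k : ℕ, y = (g^[b])^[k] x) ∧
              Function.Surjective q₁ ∧ (∀ x, (g^[b]) x ≠ x → IsLocalDiffeomorphAt (𝓡 4) (𝓡 4) ∞ q₁ x) ∧
              ∀ x, (g^[b]) x = x → ∃ (U : Set (Metric.sphere (0 : EuclideanSpace ℝ (Fin 5)) 1)) (φ : Metric.sphere (0 : EuclideanSpace ℝ (Fin 5)) 1 → EuclideanSpace ℝ (Fin 4))
                (V : Set N) (ψ : N → EuclideanSpace ℝ (Fin 4)), IsOpen U ∧ x ∈ U ∧ Set.InjOn φ U ∧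
                (∀ y ∈ U, IsLocalDiffeomorphAt (𝓡 4) (𝓡 4) ∞ φ y) ∧ IsOpen V ∧ q₁ '' U ⊆ V ∧ Set.InjOn ψ V ∧
                (∀ z ∈ V, IsLocalDiffeomorphAt (𝓡 4) (𝓡 4) ∞ ψ z) ∧
                ∀ y ∈ U, ψ (q₁ y) = Literature.Topology.FourManifolds.rotationFoldModel a (φ y))) ∧
          ∀ e : N ≃ₘ⟮𝓡 4, 𝓡 4⟯ Metric.sphere (0 : EuclideanSpace ℝ (Fin 5)) 1,
            ∃ (g' : Metric.sphere (0 : EuclideanSpace ℝ (Fin 5)) 1 → Metric.sphere (0 : EuclideanSpace ℝ (Fin 5)) 1) (q' : Metric.sphere (0 : EuclideanSpace ℝ (Fin 5)) 1 → M),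
              (∃ x, g' x = x) ∧
              (ContMDiff (𝓡 4) (𝓡 4) ∞ g' ∧ g'^[b] = id ∧ ContMDiff (𝓡 4) (𝓡 4) ∞ q' ∧
                (∀ x, q' (g' x) = q' x) ∧ (∀ x y, q' x = q' y → ∃ k : ℕ, y = g'^[k] x) ∧
                Function.Surjective q' ∧ (∀ x, g' x ≠ x → IsLocalDiffeomorphAt (𝓡 4) (𝓡 4) ∞ q' x) ∧
                ∀ x, g' x = x → ∃ (U : Set (Metric.sphere (0 : EuclideanSpace ℝ (Fin 5)) 1)) (φ : Metric.sphere (0 : EuclideanSpace ℝ (Fin 5)) 1 → EuclideanSpace ℝ (Fin 4))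
                  (V : Set M) (ψ : M → EuclideanSpace ℝ (Fin 4)), IsOpen U ∧ x ∈ U ∧ Set.InjOn φ U ∧
                  (∀ y ∈ U, IsLocalDiffeomorphAt (𝓡 4) (𝓡 4) ∞ φ y) ∧ IsOpen V ∧ q' '' U ⊆ V ∧ Set.InjOn ψ V ∧
                  (∀ z ∈ V, IsLocalDiffeomorphAt (𝓡 4) (𝓡 4) ∞ ψ z) ∧
                  ∀ y ∈ U, ψ (q' y) = Literature.Topology.FourManifolds.rotationFoldModel b (φ y))) →
    Summit.SmoothPoincare4.SmoothPoincare4.Theses.QuotientSpheres.InvolutionQuotient →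
    Summit.SmoothPoincare4.SmoothPoincare4.Theses.QuotientSpheres.CyclicQuotient :=
  cyclicQuotient_of_stubs

end Summit.SmoothPoincare4.SmoothPoincare4.Cruxes.CyclicQuotient.Birth
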